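import Mathlib
import Literature.Analysis.FluidPDE.SuitableWeak
import Summits.NavierStokesRegularity.NavierStokesRegularity.Theorems.EulerZoomLiouvillePowerGaugeEulerLiouvillePressureFloorWeightedVirial
import Summits.NavierStokesRegularity.NavierStokesRegularity.Theorems.EulerZoomLiouvillePowerGaugeEulerLiouvillePressureFloorDeficitKill
import Summits.NavierStokesRegularity.NavierStokesRegularity.Theorems.EulerZoomLiouvillePowerGaugeEulerLiouvillePressureFloorExcessKill
import HarnessLib

/-!
# Crux `EulerZoomLiouville.PowerGaugeEulerLiouville` (stmt-NavierStokesRegularity-19832), line `pressure-floor`: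
# SLICEWISE ONE-SIDED PRESSURE IN THE FAR PAST ⇒ TRIVIAL (the two sign strata, widened)

Route №10 `EulerZoomLiouville` (NavierStokesRegularity), crux E = Seregin's power-gauged ancient Euler class on
`(−∞,0) × ℝ³`.  Line `pressure-floor` (ideator ns-idea-11; `Cruxes/PowerGaugeEulerLiouville/Lines/pressure_floor.lean`).
The kills A3 (`PressureFloor.deficitKill`) and A4 (`PressureFloor.excessKill`) are SLICE-BY-SLICE arguments: a slice
`u(t)` on which the pressure is one-signed relative to `|u|²` — floor `p(t) ≥ −ε|u(t)|²` with `ε < ρ/(1+ρ)`, OR ceiling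
`p(t) ≤ −κ|u(t)|²` with `κ > 1/(2+2ρ)` — vanishes (`Kill.deficit_slice_ae_eq_zero`, `Kill.excess_slice_ae_eq_zero`), and
zero slices in a far past `t < T₁` already force triviality (`PastSymmetric.ae_eq_zero_of_gauge_of_pastSlicesZero`).
This file records the resulting WIDENED stratum: a member whose a.e. slice before some time `T₁` is one-signed (the sign,
and the constants `ε(t)`, `κ(t)`, may vary from slice to slice; NOTHING is assumed on `[T₁, 0)`) is trivial — modulo the
Newtonian bump families (A2, `Sig.stub_newtonianBumps`, hypothesis `hA2`), with the virial identity A1 discharged by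
`PressureFloor.weightedVirial_of_inClass`.  Bookkeeping point: the slice constants select the exponent `β`, and the
virial identity is available simultaneously only for COUNTABLY many weights, so the bump families are fixed once for
every RATIONAL exponent `β ∈ [0,1)` (`Kill.exists_rat_beta_deficit/excess`: the admissible `β`-sets are intervals).
Consequently the line's open residue (`stub_balancedRest`) shrinks to members whose slices CROSS both relative levels on a
positive-measure set of times in every far past.

* `Kill.exists_rat_beta_deficit`, `Kill.exists_rat_beta_excess` — rational exponent choices;
* **`ae_eq_zero_of_gauge_of_pastSlicewiseOneSided`** — the widened stratum (modulo A2).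

WHAT THIS IS NOT: not NS, not the crux — a widened union of the two thin sign strata of the crux class (MODEL lattice:
19832 is a class of Euler-side strata of a hypothetical Type-II zoom limit); `--supports` stmt-19832. [folklore]
-/

noncomputable section

-- flat `Theorems/<Route><Decl>…` files of one crux share the namespace of the crux (tree convention)
set_option linter.dupNamespace false

open MeasureTheory Set Filter Topology Metric Function
open scoped ENNReal NNReal Laplacian ContDiff

namespace Summit.NavierStokesRegularity.NavierStokesRegularity.Theorems.PowerGaugeEulerLiouville.PressureFloor

open Literature.Analysis Literature.Analysis.FunctionSpaces Literature.Analysis.FluidPDE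

/-! ### Rational exponent choices -/

/-- A RATIONAL admissible deficit exponent: for `ε < ρ/(1+ρ)`, `0 < ρ ≤ 1/2` there is `β ∈ ℚ ∩ [0,1) ∩ (1−2ρ,1)` with
`(1−β)/(3−β) > ε` (the admissible set is an interval with non-empty interior, or contains `0`). [folklore] -/
theorem Kill.exists_rat_beta_deficit {ρ ε : ℝ} (hρ : 0 < ρ) (hρ2 : ρ ≤ 1 / 2) (hε : ε < ρ / (1 + ρ)) :
    ∃ q : ℚ, (0 : ℝ) ≤ q ∧ (q : ℝ) < 1 ∧ 1 - 2 * ρ < q ∧ ε < (1 - (q : ℝ)) / (3 - q) := by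
  obtain ⟨β, hβ0, hβ1, hβρ, hεm⟩ := Kill.exists_beta_deficit hρ hρ2 hε
  rcases hβ0.eq_or_lt with h0 | hpos
  · refine ⟨0, by simp, by simp, ?_, ?_⟩
    · simp only [Rat.cast_zero]; linarith
    · simp only [Rat.cast_zero]; rw [← h0] at hεm; simpa using hεm
  · obtain ⟨q, hq1, hq2⟩ := exists_rat_btwn (max_lt hβρ hpos)
    have hq0 : (0 : ℝ) < q := lt_of_le_of_lt (le_max_right _ _) hq1
    have hqρ : 1 - 2 * ρ < q := lt_of_le_of_lt (le_max_left _ _) hq1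
    refine ⟨q, hq0.le, by linarith, hqρ, lt_of_lt_of_le hεm ?_⟩
    rw [div_le_div_iff₀ (by linarith) (by linarith)]
    nlinarith

/-- A RATIONAL admissible excess exponent: for `κ > 1/(2+2ρ)`, `0 < ρ ≤ 1/2` there is `β ∈ ℚ ∩ [0,1) ∩ (1−2ρ,1)` with
`1/(3−β) < κ`. [folklore] -/
theorem Kill.exists_rat_beta_excess {ρ κ : ℝ} (hρ : 0 < ρ) (hρ2 : ρ ≤ 1 / 2) (hκ : 1 / (2 + 2 * ρ) < κ) :
    ∃ q : ℚ, (0 : ℝ) ≤ q ∧ (q : ℝ) < 1 ∧ 1 - 2 * ρ < q ∧ 1 / (3 - (q : ℝ)) < κ := by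
  obtain ⟨β, hβ0, hβ1, hβρ, hMκ⟩ := Kill.exists_beta_excess hρ hρ2 hκ
  rcases hβ0.eq_or_lt with h0 | hpos
  · refine ⟨0, by simp, by simp, ?_, ?_⟩
    · simp only [Rat.cast_zero]; linarith
    · simp only [Rat.cast_zero]; rw [← h0] at hMκ; simpa using hMκ
  · obtain ⟨q, hq1, hq2⟩ := exists_rat_btwn (max_lt hβρ hpos)
    have hq0 : (0 : ℝ) < q := lt_of_le_of_lt (le_max_right _ _) hq1
    have hqρ : 1 - 2 * ρ < q := lt_of_le_of_lt (le_max_left _ _) hq1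
    refine ⟨q, hq0.le, by linarith, hqρ, lt_of_le_of_lt ?_ hMκ⟩
    exact one_div_le_one_div_of_le (by linarith) (by linarith)

/-! ### The widened stratum -/

/-- **Slicewise one-sided pressure in a far past ⇒ trivial (modulo the bump families A2).**  Let `(u, p, H, c)` be a
member of Seregin's power-gauged ancient Euler class with `0 < ρ ≤ 1/2`, assume the Newtonian bump families exist at every
exponent `β ∈ [0,1)` (`hA2` = the line's `Sig.stub_newtonianBumps`, unfolded), and suppose that for a.e. time `t < T₁`
(`T₁` arbitrary; nothing is assumed on `[T₁,0)`) the slice is ONE-SIGNED: either `p(t,·) ≥ −ε|u(t,·)|²` a.e. for some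
`ε < ρ/(1+ρ)`, or `p(t,·) ≤ −κ|u(t,·)|²` a.e. for some `κ > 1/(2+2ρ)` (sign and constants may depend on `t`).  Then
`u = 0` a.e. on the slab.  Proof: fix the bump families for all RATIONAL exponents (countably many weights, so the virial
identities `weightedVirial_of_inClass` hold for all of them on a.e. slice); on a good slice pick a rational admissible
`β` (`Kill.exists_rat_beta_deficit/excess`) and kill the slice by `Kill.deficit_slice_ae_eq_zero` /
`Kill.excess_slice_ae_eq_zero`; conclude by `PastSymmetric.ae_eq_zero_of_gauge_of_pastSlicesZero` below `min T₁ 0`.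
[folklore] -/
theorem ae_eq_zero_of_gauge_of_pastSlicewiseOneSided {ρ : ℝ} (hρ : 0 < ρ) (hρ2 : ρ ≤ 1 / 2)
    {u : ℝ → EuclideanSpace ℝ (Fin 3) → EuclideanSpace ℝ (Fin 3)} {p : ℝ → EuclideanSpace ℝ (Fin 3) → ℝ}
    {H : ℝ → EuclideanSpace ℝ (Fin 3) → EuclideanSpace ℝ (Fin 3) →L[ℝ] EuclideanSpace ℝ (Fin 3)} {c : ℝ≥0}
    (hsw : IsSuitableWeakSolutionOn (slab (EuclideanSpace ℝ (Fin 3)) (Set.Iio 0) isOpen_Iio) 0 0 u p)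
    (hH : HasWeakSpatialGradientOn (slab (EuclideanSpace ℝ (Fin 3)) (Set.Iio 0) isOpen_Iio) u H)
    (hc : ∀ a : ℝ, 0 < a →
      ENNReal.ofReal (a ^ (2 * ρ)) * cknA a (0 : ℝ × EuclideanSpace ℝ (Fin 3)) u +
        ENNReal.ofReal (a ^ ρ) * cknE a (0 : ℝ × EuclideanSpace ℝ (Fin 3)) H +
        ENNReal.ofReal (a ^ (2 * ρ)) * cknD a (0 : ℝ × EuclideanSpace ℝ (Fin 3)) p ≤ (c : ℝ≥0∞))
    (hA2 : ∀ β : ℝ, 0 ≤ β → β < 1 →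
        ∃ C : ℝ, ∀ R : ℝ, 1 ≤ R → ∃ Ψ : EuclideanSpace ℝ (Fin 3) → ℝ,
          (ContDiff ℝ ∞ Ψ ∧ ∃ K : ℝ, ∀ x : EuclideanSpace ℝ (Fin 3),
            |Ψ x| ≤ K / (1 + ‖x‖) ∧ ‖fderiv ℝ Ψ x‖ ≤ K / (1 + ‖x‖) ^ 2 ∧
              ∀ v : EuclideanSpace ℝ (Fin 3),
                |fderiv ℝ (fderiv ℝ Ψ) x v v| ≤ K / (1 + ‖x‖) ^ 3 * ‖v‖ ^ 2) ∧
          (∀ x : EuclideanSpace ℝ (Fin 3), 0 ≤ Δ Ψ x ∧ Δ Ψ x ≤ (1 + ‖x‖ ^ 2) ^ (-(β / 2))) ∧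
          (∀ x : EuclideanSpace ℝ (Fin 3), ‖x‖ ≤ R → Δ Ψ x = (1 + ‖x‖ ^ 2) ^ (-(β / 2))) ∧
          (∀ x : EuclideanSpace ℝ (Fin 3), 2 * R ≤ ‖x‖ → Δ Ψ x = 0) ∧
          (∀ x : EuclideanSpace ℝ (Fin 3), ‖x‖ ≤ R → ∀ v : EuclideanSpace ℝ (Fin 3),
              (1 - β) / (3 - β) * (1 + ‖x‖ ^ 2) ^ (-(β / 2)) * ‖v‖ ^ 2 ≤ fderiv ℝ (fderiv ℝ Ψ) x v v ∧
                fderiv ℝ (fderiv ℝ Ψ) x v v ≤ 1 / (3 - β) * (1 + ‖x‖ ^ 2) ^ (-(β / 2)) * ‖v‖ ^ 2) ∧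
          (∀ x : EuclideanSpace ℝ (Fin 3), R ≤ ‖x‖ → ∀ v : EuclideanSpace ℝ (Fin 3),
              |fderiv ℝ (fderiv ℝ Ψ) x v v| ≤ C * R ^ (3 - β) / ‖x‖ ^ 3 * ‖v‖ ^ 2))
    {T₁ : ℝ}
    (hone : ∀ᵐ t ∂(volume.restrict (Set.Iio T₁)),
      (∃ ε : ℝ, ε < ρ / (1 + ρ) ∧
          ∀ᵐ x ∂(volume : Measure (EuclideanSpace ℝ (Fin 3))), -ε * ‖u t x‖ ^ 2 ≤ p t x) ∨
        (∃ κ : ℝ, 1 / (2 + 2 * ρ) < κ ∧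
          ∀ᵐ x ∂(volume : Measure (EuclideanSpace ℝ (Fin 3))), p t x ≤ -κ * ‖u t x‖ ^ 2)) :
    Function.uncurry u =ᵐ[volume.restrict (Set.Iio (0 : ℝ) ×ˢ (Set.univ : Set (EuclideanSpace ℝ (Fin 3))))] 0 := by
  -- bump families for every rational exponent in `[0,1)`, one weight per natural radius
  have hR1 : ∀ n : ℕ, (1 : ℝ) ≤ (n : ℝ) + 1 := fun n => by
    have : (0 : ℝ) ≤ n := n.cast_nonneg
    linarith
  choose C hC using fun s : {q : ℚ // (0 : ℝ) ≤ q ∧ (q : ℝ) < 1} => hA2 (s.1 : ℝ) s.2.1 s.2.2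
  choose Ψ hΨ using fun (s : {q : ℚ // (0 : ℝ) ≤ q ∧ (q : ℝ) < 1}) (n : ℕ) => hC s ((n : ℝ) + 1) (hR1 n)
  have hW := weightedVirial_of_inClass ρ hρ u p H c ⟨hsw, hH, hc⟩
  have hvir : ∀ᵐ t ∂(volume.restrict (Iio (0 : ℝ))), ∀ s : {q : ℚ // (0 : ℝ) ≤ q ∧ (q : ℝ) < 1}, ∀ n : ℕ,
      Integrable (fun x : EuclideanSpace ℝ (Fin 3) => fderiv ℝ (fderiv ℝ (Ψ s n)) x (u t x) (u t x)) ∧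
        Integrable (fun x : EuclideanSpace ℝ (Fin 3) => p t x * Δ (Ψ s n) x) ∧
          (∫ x, fderiv ℝ (fderiv ℝ (Ψ s n)) x (u t x) (u t x)) + ∫ x, p t x * Δ (Ψ s n) x = 0 :=
    ae_all_iff.2 fun s => ae_all_iff.2 fun n => hW (Ψ s n) (hΨ s n).1
  have hum : AEStronglyMeasurable (uncurry u)
      (volume.restrict (Iio (0 : ℝ) ×ˢ (univ : Set (EuclideanSpace ℝ (Fin 3))))) := by
    have := hH.locallyIntegrableOn.aestronglyMeasurable
    simpa [slab] using this
  have hmeas : ∀ᵐ t ∂(volume.restrict (Iio (0 : ℝ))), t < 0 → AEStronglyMeasurable (u t) volume :=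
    ae_restrict_of_ae (ae_slice_aestronglyMeasurable hum)
  have ht0 : ∀ᵐ t ∂(volume.restrict (Iio (0 : ℝ))), t ∈ Iio (0 : ℝ) := ae_restrict_mem measurableSet_Iio
  have hone' : ∀ᵐ t ∂(volume.restrict (Iio (0 : ℝ))), t ∈ Iio T₁ →
      ((∃ ε : ℝ, ε < ρ / (1 + ρ) ∧
          ∀ᵐ x ∂(volume : Measure (EuclideanSpace ℝ (Fin 3))), -ε * ‖u t x‖ ^ 2 ≤ p t x) ∨
        (∃ κ : ℝ, 1 / (2 + 2 * ρ) < κ ∧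
          ∀ᵐ x ∂(volume : Measure (EuclideanSpace ℝ (Fin 3))), p t x ≤ -κ * ‖u t x‖ ^ 2)) :=
    ae_restrict_of_ae ((ae_restrict_iff' measurableSet_Iio).1 hone)
  have hA := hasScaledLocalEnergyBound_of_gauge hc
  have hγ1 : 1 - 2 * ρ ≤ 1 := by linarith
  -- every good slice before `T₁` vanishes
  have key : ∀ᵐ t ∂(volume.restrict (Iio (0 : ℝ))), t < T₁ → ∫⁻ x, ‖u t x‖ₑ ^ 2 = 0 := by
    filter_upwards [hvir, hmeas, ht0, hone'] with t hvir hmeas ht hone hT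
    have ht' : t < 0 := ht
    have hv : AEStronglyMeasurable (u t) volume := hmeas ht'
    have hAt : ∀ a : ℝ, Real.sqrt (-t) + 1 ≤ a →
        ∫⁻ x in ball (0 : EuclideanSpace ℝ (Fin 3)) a, ‖u t x‖ₑ ^ 2 ≤
          ENNReal.ofReal ((c : ℝ) * a ^ (1 - 2 * ρ)) := by
      intro a ha
      have hs0 : 0 ≤ Real.sqrt (-t) := Real.sqrt_nonneg _
      have ha0 : 0 < a := by linarith
      refine hA a ha0 t ⟨?_, ht'⟩
      have h1 : Real.sqrt (-t) ^ 2 = -t := Real.sq_sqrt (by linarith)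
      nlinarith
    -- the tidal constant of a family, made non-negative
    have htidal' : ∀ (s : {q : ℚ // (0 : ℝ) ≤ q ∧ (q : ℝ) < 1}) (n : ℕ) (x : EuclideanSpace ℝ (Fin 3)),
        (n : ℝ) + 1 ≤ ‖x‖ → ∀ y : EuclideanSpace ℝ (Fin 3), |fderiv ℝ (fderiv ℝ (Ψ s n)) x y y| ≤
          max (C s) 0 * ((n : ℝ) + 1) ^ (3 - (s.1 : ℝ)) / ‖x‖ ^ 3 * ‖y‖ ^ 2 := by
      intro s n x hx y
      refine le_trans ((hΨ s n).2.2.2.2.2 x hx y) ?_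
      have hn0 : (0 : ℝ) ≤ (n : ℝ) + 1 := by linarith [hR1 n]
      exact mul_le_mul_of_nonneg_right (div_le_div_of_nonneg_right
        (mul_le_mul_of_nonneg_right (le_max_left (C s) 0) (Real.rpow_nonneg hn0 _))
        (pow_nonneg (norm_nonneg _) 3)) (sq_nonneg _)
    have hzero : u t =ᵐ[volume] 0 := by
      rcases hone hT with ⟨ε, hε, hdef⟩ | ⟨κ, hκ, hexc⟩
      · -- a deficit slice
        obtain ⟨q, hq0, hq1, hqρ, hεm⟩ := Kill.exists_rat_beta_deficit hρ hρ2 hε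
        set s : {q : ℚ // (0 : ℝ) ≤ q ∧ (q : ℝ) < 1} := ⟨q, hq0, hq1⟩ with hs
        have hm0 : 0 < (1 - (q : ℝ)) / (3 - q) := div_pos (by linarith) (by linarith)
        have hdef2 : ∀ᵐ x ∂(volume : Measure (EuclideanSpace ℝ (Fin 3))),
            -(max ε 0) * ‖u t x‖ ^ 2 ≤ p t x := by
          filter_upwards [hdef] with x hx
          exact le_trans (mul_le_mul_of_nonneg_right (neg_le_neg (le_max_left ε 0)) (sq_nonneg _)) hx
        exact Kill.deficit_slice_ae_eq_zero hv c.coe_nonneg hγ1 (by positivity) hAt hqρ (le_max_right ε 0)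
          (max_lt hεm hm0) (le_max_right (C s) 0) hdef2
          (w := fun x : EuclideanSpace ℝ (Fin 3) => (1 + ‖x‖ ^ 2) ^ (-((q : ℝ) / 2)))
          (fun x => Kill.powerProfile_pos_le_one hq0 x)
          (Kill.continuous_powerProfile (q : ℝ)).aestronglyMeasurable
          (fun R hR x hx => Kill.powerProfile_le_rpow_neg hq0 hR hx)
          (Ψ := Ψ s) (fun n => (hΨ s n).2.1) (fun n => (hΨ s n).2.2.1) (fun n => (hΨ s n).2.2.2.1)
          (fun n x hx y => ((hΨ s n).2.2.2.2.1 x hx y).1) (htidal' s) (hvir s)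
      · -- an excess slice
        obtain ⟨q, hq0, hq1, hqρ, hMκ⟩ := Kill.exists_rat_beta_excess hρ hρ2 hκ
        set s : {q : ℚ // (0 : ℝ) ≤ q ∧ (q : ℝ) < 1} := ⟨q, hq0, hq1⟩ with hs
        have hκ0 : 0 ≤ κ := by
          have : (0 : ℝ) < 1 / (2 + 2 * ρ) := by positivity
          linarith
        exact Kill.excess_slice_ae_eq_zero hv c.coe_nonneg hγ1 (by positivity) hAt hqρ hκ0 hMκ
          (le_max_right (C s) 0) hexc
          (w := fun x : EuclideanSpace ℝ (Fin 3) => (1 + ‖x‖ ^ 2) ^ (-((q : ℝ) / 2)))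
          (fun x => Kill.powerProfile_pos_le_one hq0 x)
          (Kill.continuous_powerProfile (q : ℝ)).aestronglyMeasurable
          (Ψ := Ψ s) (fun n x => ((hΨ s n).2.1 x).1) (fun n => (hΨ s n).2.2.1)
          (fun n x hx y => ((hΨ s n).2.2.2.2.1 x hx y).2) (htidal' s) (hvir s)
    calc ∫⁻ x, ‖u t x‖ₑ ^ 2 = ∫⁻ x, ‖(0 : EuclideanSpace ℝ (Fin 3) → EuclideanSpace ℝ (Fin 3)) x‖ₑ ^ 2 :=
          lintegral_congr_ae (by filter_upwards [hzero] with x hx; rw [hx])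
      _ = 0 := by simp
  -- zero slices below `min T₁ 0`
  have hslice : ∀ᵐ t ∂(volume.restrict (Iio (min T₁ 0))), ∫⁻ x, ‖u t x‖ₑ ^ 2 = 0 := by
    have h1 : ∀ᵐ t ∂(volume.restrict (Iio (min T₁ 0))), t < T₁ → ∫⁻ x, ‖u t x‖ₑ ^ 2 = 0 :=
      ae_restrict_of_ae_restrict_of_subset (Iio_subset_Iio (min_le_right _ _)) key
    have h2 : ∀ᵐ t ∂(volume.restrict (Iio (min T₁ 0))), t ∈ Iio (min T₁ 0) := ae_restrict_mem measurableSet_Iio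
    filter_upwards [h1, h2] with t h ht
    exact h (lt_of_lt_of_le ht (min_le_left _ _))
  exact PastSymmetric.ae_eq_zero_of_gauge_of_pastSlicesZero hρ.le hsw hH hc (T₁ := min T₁ 0) hslice

end Summit.NavierStokesRegularity.NavierStokesRegularity.Theorems.PowerGaugeEulerLiouville.PressureFloor

end
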